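import Mathlib
import Literature.MathematicalPhysics.QuantumFieldTheory.Balaban1983to89.Beta.EffectiveKernelCoercive

/-!
# Beta / FluctuationCovariance — B4 Proposition 2.3 (1.15)/(1.16) ON THE TORUS AT `A = 0`, by B4's own §5 route:
uniform bounds and exponential decay of the one-step FLUCTUATION COVARIANCE
`C = (K_eff + (a₂/L²)·Q_L* Q_L)⁻¹` of the scalar site-averaged model, for every mesh and every volume

HONEST FRAMING (verbatim, page 1 of everything this cell writes): discharging `BetaPertH` makes Bałaban's UV
stability UNCONDITIONAL — a real constructive-QFT result; it is NOT the continuum limit and NOT the Clay problem.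
Gloss (BETA-SPEC v1.9b l. 17–18, G-ref2-14 (a) / G-ref2-20 (a)): «UNCONDITIONAL» in [Balaban1989LargeFieldII] (B16)
p. 355's interval-hypothesis sense ONLY (`FlowStepRuns.p355Unconditional_of_partialSums` keeps `hnodes`); the located
leaves G-adv3-2, G-adv3-1 and `SecondExpLeaf` REMAIN.  THIS MODULE discharges nothing of that: it is a
Mathlib-elementary certificate about the scalar (one-component, `U = 1`, no gauge field) site-averaged toy operator of
`Beta/EffectiveKernel` / `Beta/EffectiveKernelCoercive` (unit an5-g4) and `Beta/TorusG0Decay` (unit pv23-g3); nothing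
printed by Bałaban, King or Dimock is asserted and NO hypothesis is a quotation (ABSOLUTE RULE of the cell: zero cited
facts here; every `theorem` below is kernel-checked, tagged [folklore]).

CONTEXT (located print, NOT used as input).  [Balaban1983RegularityDecay] = B4 (Commun. Math. Phys. 89, 571–597), p. 573
(1.13) `C_Λ^{(k)}(Ω,A) = ((Δ^{(k)}(Ω,A) + aL⁻²P(A))|_Λ)⁻¹`, (1.14) `Δ^{(k)}(Ω,A) = a_k I − a_k² Q_k(A) G_k(Ω,A) Q_k*(A)`;
p. 574, Proposition 2.3 of [1]: «There exist positive constants δ₀, c₀, γ₀, γ₁ dependent on d and M only and such that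
for arbitrary Λ ⊂ Ω^{(k)} = Ω∩Z^d, Λ being a sum of big blocks and for e sufficiently small, we have
γ₀I ≤ Δ^{(k)}(Ω,A) + aL⁻²P(A) ≤ γ₁I (1.15), |C_Λ^{(k)}(Ω,A; x,x′)| ≤ c₀ exp(−δ₀|x − x′|), x, x′ ∈ Λ (1.16).»; p. 574
l. −8: «The fifth section will be devoted to a general theorem concerning operators on the unit lattice Z^d. There we
have abstracted some basic features of our method and we have proven a theorem which, if applied to operators (1.14),
gives another proof of Proposition 2.3.»  THIS FILE IS EXACTLY THAT APPLICATION, for the torus, `A = 0`, one component: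
the §5 theorem is KERNEL in the tree (`B4Sect5Torus.inv_decay` / `inv_submatrix_decay`, unit pv09-g4, over an arbitrary
pseudo-distance), the operator (1.14) is an5-g4's `Keff n M a₁ = a₁·1 − (a₁²/(n+1)^d)·ind G₀ indᵀ` (its dictionary to
(1.14): `Q_k = (n+1)^{−d}·ind`, `Q_k* = indᵀ`, `G_k = G0 n M a₁ = (−Δ^η + a₁Q_k*Q_k)⁻¹` as linear maps, `η = 1/(n+1) = L^{−k}`),
and hypothesis (5.6) «A ≥ γ₀I, |A(x,x′)| ≤ c₀e^{−δ₀|x−x′|}» is CERTIFIED here from an5-g4's uniform coercivity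
`Keff_form_ge_dirichletT` + pv23-g3's `coercive_torus` (read as the block Poincaré inequality WITH the next averaging
constraint on the unit torus) + an5-g4's entry decay `Keff_abs_le`.  Also context: [Dimock2013] (arXiv:1108.1335) §2.3
`C_k = (Δ_k + (a/L²)QᵀQ)⁻¹` and App. D (Cbound) — the same object in the expository account; B4 p. 588 l. 4 «the constants
… depend on L» — so do ours (γ₀ ∝ L⁻², see HONEST SCOPE).

THE SETTING (all objects from the imports).  Three lattices: the fine torus `T_η = Tor (fine (n+1) (fine (ℓ+1) M′))`
(mesh `η = 1/(n+1)` in unit-lattice units), the UNIT torus `U = Tor (fine (ℓ+1) M′)` (periods `(ℓ+1)·M′_μ`), and the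
NEXT torus `Tor M′` of `L`-blocks, `L = ℓ + 1`.  On `U`: an5's `Keff n (fine (ℓ+1) M′) a₁` (parameter `a₁` = B4's `a_k`),
the next block-averaging projection `blockP ℓ M′ = L^{−d}·(ind ℓ M′)ᵀ(ind ℓ M′)` (= `Q_L*Q_L = P(0)` of (1.13) on the unit
lattice), and
  `Cop n ℓ M′ a₁ a₂ = Keff n (fine (ℓ+1) M′) a₁ + (a₂/L²)·blockP ℓ M′`   (= `Δ^{(k)} + aL⁻²P` of (1.13)/(1.15), `a₂` = B4's `a`),
  `Cfl n ℓ M′ a₁ a₂ = (Cop n ℓ M′ a₁ a₂)⁻¹`                              (= `C^{(k)}` of (1.13) with `Λ = Ω =` the torus).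

WHAT IS PROVED (zero `sorry`; every constant explicit; uniform in the mesh `n` (= the level `k`) and in the volume `M′`):
 §2 `lap_form_eq_dirichletT`: `⟨g, lap_c g⟩ = c·E(g)` on any torus with periods `≥ 3` (the equality behind an5's `≥`).
 §3 `blockP`: entries `L^{−d}·1{same L-block}`, form `L^{−d}‖ind ψ‖² ∈ [0, ‖ψ‖²]`, symmetric.
 §4 (1.15) KERNEL: `gamma0 · ‖ψ‖² ≤ ⟨ψ, Cop ψ⟩ ≤ gamma1 · ‖ψ‖²` with
      `gamma0 d ℓ a₁ a₂ = min(2·min(a₁/(8d), 1/2), a₂)/L²`,  `gamma1 ℓ a₁ a₂ = a₁ + a₂/L²`   (`Cop_form_ge`, `Cop_form_le`);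
    the lower bound is `Keff ≥ c_K·(−Δ₁)` (an5) plus `c_K·(−Δ₁) + (a₂/L²)Q_L*Q_L ≥ gamma0` = pv23-g3's `coercive_torus` on `U`
    with parameter `a₂/c_K`, rescaled by `c_K/L²` (§2 supplies the form identity).
 §5 (5.6) KERNEL: `|Cop(b,b′)| ≤ c0 · e^{−delta0·ldist_U(b,b′)}`, `delta0 = min(δ_std(d,a₁), 1/L)` (an5's standard
    Combes–Thomas rate, capped so that the same-block support of `blockP` (diameter `ℓ`) costs only a factor `e`),
    `c0 = a₁ + e·(a₁²(2/min(2,a₁)) + a₂/(L²L^d))`  (`Cop_entry_bound`); `Cop` is symmetric; hence `Hyp56 ldist Cop gamma0 c0 delta0`.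
 §6 (1.16) KERNEL (`Cfl_entry_decay`): for `d ≥ 1`, `a₁, a₂ > 0`, unit periods `(ℓ+1)M′_μ ≥ 3`, EVERY mesh `n` and all
    `b, b′ ∈ U`:  `|Cfl(b,b′)| ≤ (2/gamma0) · exp(−delta1 · ldist_U(b,b′))`,
    `delta1 = B4Sect5Torus.rate (latticeConst d) gamma0 c0 delta0 = min(delta0/4, gamma0/(2M₀+1)) > 0`,
    `M₀ = c0(4/delta0)K_d(delta0/2)` — pv09's finite-volume Combes–Thomas theorem `inv_decay` with the torus profile
    `EffectiveKernel.sum_exp_ldist_le`; and the same bound with the SAME constants for every compression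
    `((Cop).submatrix e e)⁻¹` along an injection `e` (`Cfl_submatrix_entry_decay`; B4's `Λ`, here an ARBITRARY subset).
 §7 non-vacuity at `d = 4`.

HONEST SCOPE.  (i) Scalar, one component, `A = 0`, periodic boundary conditions: the covariant/`Ω`-localised statements
(1.17)–(1.20) and anything about `U(A(Γ))` are NOT touched.  (ii) The constants DEPEND ON `L = ℓ+1`: `gamma0 ∝ L⁻²`
(this is the true order of the bottom of the spectrum of `K_eff + (a₂/L²)Q_L*Q_L` on functions varying on scale `L`), and
the certified rate `delta1 ≤ gamma0/(2M₀+1)` inherits it — adequate for the cell's FIXED-`L₀` sub-slicing road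
(lead READING of G-sb12-4, 2026-08-18T23:52:59Z, input (S2): «fluctuation covariances C^(l) ((1.16)-type) at fixed L₀,
k-uniform»), NOT an `L`-uniform statement (road (α) of G-sb12-4 is not served by this file).  (iii) Distances are the
sup-metric `ldist` of the unit torus (pv23-g3/pv09), rates are per unit-lattice step.  (iv) This is the covariance of
the unit-lattice fluctuation field of ONE renormalisation step of the Gaussian site-averaged model; the identification
with the `C^{(k)}` inside B12's `β`-recursion is the cell's (S1) identity (an1-g4, `Beta/ScaleTransport`), not this file.
Cell records: GAPS.md C-pv23g4-1, node G-sb12-4-S2-KERNELS (A) (journal CLAIM 2026-08-19).  Unit `b2b-balaban-pv23-g4`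
(SURGE NODE PROVER #23, gen 4); staged byte-identically under `HOME/lean/BalabanYm4/`.  Value = kernel certificate of a
printed-claimed per-step input for a toy operator, NOT summit progress, NOT the continuum limit.
-/

open Finset Matrix

namespace Literature.MathematicalPhysics.QuantumFieldTheory.Balaban1983to89.Beta.FluctuationCovariance

noncomputable section

open B5Prop11Plancherel (Tor fine unitVec)
open CombesThomasForm (lap lap_form)
open TorusG0Decay (torusOp coupling coupling_symm coupling_bond filter_adj_eq_image pm_injective coercive_torus
  ldist ldist_self ldist_symm ldist_triangle ldist_le_of_same_block)
open TorusG0Kernel (G0)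
open EffectiveKernel (ind ind_apply Keff Keff_transpose Keff_abs_le Keff_form_le torusOp_form_eq deltaStd deltaStd_pos
  deltaStd_le_one deltaStd_small sum_exp_ldist_le)
open EffectiveKernelCoercive (dirichletT dirichletT_nonneg Keff_form_ge_dirichletT ind_mulVec_eq sum_fine_eq_sum_blocks)
open B4Sect5Proof (latticeConst latticeConst_nonneg)
open B4Sect5Torus (IsPseudoDist SumBound Hyp56 rate rate_pos inv_decay inv_submatrix_decay)

/-! ## §2  The Laplacian form identity on a torus with periods `≥ 3` -/

section LapForm

variable {d : ℕ} (N : Fin d → ℕ) [hN : ∀ μ, NeZero (N μ)]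

/-- **`⟨g, lap_c g⟩ = c · E(g)`** on the torus `Tor N` with all periods `≥ 3` (so that the `2d` neighbours `x ± e_μ` are
distinct), `E = dirichletT` the nearest-neighbour Dirichlet form; `c ≠ 0`. [folklore] -/
theorem lap_form_eq_dirichletT (h3 : ∀ μ, 3 ≤ N μ) {c : ℝ} (hc : c ≠ 0) (g : Tor N → ℝ) :
    g ⬝ᵥ (lap (coupling N c)).mulVec g = c * dirichletT N g := by
  classical
  rw [lap_form _ (coupling_symm N c)]
  have hinner : ∀ j : Tor N, ∑ k, coupling N c j k * (g j - g k) ^ 2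
      = c * ∑ μ : Fin d, ((g j - g (j + unitVec N μ)) ^ 2 + (g j - g (j - unitVec N μ)) ^ 2) := by
    intro j
    have hrestrict : ∑ k, coupling N c j k * (g j - g k) ^ 2
        = ∑ k ∈ univ.filter (fun k => coupling N c j k ≠ 0), coupling N c j k * (g j - g k) ^ 2 := by
      rw [Finset.sum_filter]
      refine Finset.sum_congr rfl fun k _ => ?_
      by_cases h : coupling N c j k ≠ 0
      · rw [if_pos h]
      · rw [if_neg h, not_not.mp h, zero_mul]
    rw [hrestrict, filter_adj_eq_image N c hc j,
      Finset.sum_image fun p _ q _ h => pm_injective N h3 j h, Fintype.sum_prod_type, Finset.mul_sum]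
    refine Finset.sum_congr rfl fun μ _ => ?_
    rw [Fintype.sum_bool]
    simp only [ite_true, Bool.false_eq_true, ite_false]
    rw [coupling_bond, show coupling N c j (j - unitVec N μ) = c by
      unfold coupling; rw [if_pos ⟨μ, Or.inr (by simp)⟩]]
    ring
  have hA : ∑ j : Tor N, ∑ μ : Fin d, (g j - g (j + unitVec N μ)) ^ 2 = dirichletT N g := by
    simp only [dirichletT]
    exact Finset.sum_congr rfl fun j _ => Finset.sum_congr rfl fun μ _ => by ring
  have hB : ∑ j : Tor N, ∑ μ : Fin d, (g j - g (j - unitVec N μ)) ^ 2 = dirichletT N g := by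
    rw [dirichletT, Finset.sum_comm]
    conv_rhs => rw [Finset.sum_comm]
    refine Finset.sum_congr rfl fun μ _ => ?_
    exact (Fintype.sum_equiv (Equiv.addRight (unitVec N μ))
      (fun j => (g (j + unitVec N μ) - g j) ^ 2) (fun j => (g j - g (j - unitVec N μ)) ^ 2)
      (fun j => by simp only [Equiv.coe_addRight, add_sub_cancel_right])).symm
  simp only [hinner]
  rw [← Finset.mul_sum]
  have hsplit : ∑ j : Tor N, ∑ μ : Fin d, ((g j - g (j + unitVec N μ)) ^ 2 + (g j - g (j - unitVec N μ)) ^ 2)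
      = dirichletT N g + dirichletT N g := by
    rw [← hA]
    conv_rhs => arg 2; rw [hA, ← hB]
    rw [← Finset.sum_add_distrib]
    exact Finset.sum_congr rfl fun j _ => Finset.sum_add_distrib
  rw [hsplit]
  ring

end LapForm

/-! ## §3  The next block-averaging projection on the unit torus -/

section Setting

variable {d : ℕ} (n ℓ : ℕ) (M' : Fin d → ℕ) [hM : ∀ μ, NeZero (M' μ)]

/-- **`blockP = L^{−d} · indᵀ ind = Q_L* Q_L`** on the unit torus `U = Tor (fine (ℓ+1) M′)`: averaging over the
`L`-blocks (`L = ℓ+1`) then spreading — the `P = P(0)` of B4 (1.13) at `A = 0` (OUR definition). [folklore] -/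
def blockP : Matrix (Tor (fine (ℓ + 1) M')) (Tor (fine (ℓ + 1) M')) ℝ :=
  (1 / ((ℓ : ℝ) + 1) ^ d) • ((ind ℓ M')ᵀ * ind ℓ M')

/-- **The one-step fluctuation precision** `Cop = K_eff(a₁) + (a₂/L²)·Q_L*Q_L` on the unit torus (= B4's
`Δ^{(k)} + aL⁻²P` of (1.13)/(1.15) for the torus at `A = 0`, `a_k = a₁`, `a = a₂`; OUR definition). [folklore] -/
def Cop (a₁ a₂ : ℝ) : Matrix (Tor (fine (ℓ + 1) M')) (Tor (fine (ℓ + 1) M')) ℝ :=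
  Keff n (fine (ℓ + 1) M') a₁ + (a₂ / ((ℓ : ℝ) + 1) ^ 2) • blockP ℓ M'

/-- **The one-step fluctuation covariance** `Cfl = Cop⁻¹` (= B4's `C^{(k)}` of (1.13) with `Λ = Ω =` the torus, `A = 0`;
OUR definition). [folklore] -/
def Cfl (a₁ a₂ : ℝ) : Matrix (Tor (fine (ℓ + 1) M')) (Tor (fine (ℓ + 1) M')) ℝ := (Cop n ℓ M' a₁ a₂)⁻¹

/-- entries of `indᵀ ind`: `1` iff the two unit sites lie in the same `L`-block. [folklore] -/
theorem indTind_apply (b b' : Tor (fine (ℓ + 1) M')) :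
    ((ind ℓ M')ᵀ * ind ℓ M') b b'
      = if B5Blocks16.blockOf (ℓ + 1) M' b = B5Blocks16.blockOf (ℓ + 1) M' b' then 1 else 0 := by
  simp only [Matrix.mul_apply, Matrix.transpose_apply, ind_apply]
  rw [Finset.sum_eq_single (B5Blocks16.blockOf (ℓ + 1) M' b)]
  · rw [if_pos rfl, one_mul]
    by_cases h : B5Blocks16.blockOf (ℓ + 1) M' b = B5Blocks16.blockOf (ℓ + 1) M' b'
    · rw [if_pos h, if_pos h.symm]
    · rw [if_neg h, if_neg (fun h' => h h'.symm)]
  · intro B _ hB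
    rw [if_neg (fun h => hB h.symm), zero_mul]
  · intro h; exact absurd (Finset.mem_univ _) h

/-- entries of `blockP`: `L^{−d}·1{same block}`. [folklore] -/
theorem blockP_apply (b b' : Tor (fine (ℓ + 1) M')) :
    blockP ℓ M' b b' = (1 / ((ℓ : ℝ) + 1) ^ d)
      * (if B5Blocks16.blockOf (ℓ + 1) M' b = B5Blocks16.blockOf (ℓ + 1) M' b' then 1 else 0) := by
  rw [blockP, Matrix.smul_apply, smul_eq_mul, indTind_apply]

/-- `0 ≤ blockP(b,b′) ≤ L^{−d}`. [folklore] -/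
theorem blockP_apply_abs_le (b b' : Tor (fine (ℓ + 1) M')) :
    |blockP ℓ M' b b'| ≤ 1 / ((ℓ : ℝ) + 1) ^ d := by
  rw [blockP_apply]
  have h0 : (0 : ℝ) ≤ 1 / ((ℓ : ℝ) + 1) ^ d := by positivity
  split_ifs
  · rw [mul_one, abs_of_nonneg h0]
  · rw [mul_zero, abs_zero]; exact h0

/-- `blockP` vanishes between different blocks. [folklore] -/
theorem blockP_apply_of_ne {b b' : Tor (fine (ℓ + 1) M')}
    (h : B5Blocks16.blockOf (ℓ + 1) M' b ≠ B5Blocks16.blockOf (ℓ + 1) M' b') : blockP ℓ M' b b' = 0 := by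
  rw [blockP_apply, if_neg h, mul_zero]

/-- `blockP` is symmetric. [folklore] -/
theorem blockP_transpose : (blockP ℓ M')ᵀ = blockP ℓ M' := by
  rw [blockP, Matrix.transpose_smul, Matrix.transpose_mul, Matrix.transpose_transpose]

/-- the form of `blockP`: `⟨ψ, blockP ψ⟩ = L^{−d} ‖ind ψ‖²`. [folklore] -/
theorem blockP_form (ψ : Tor (fine (ℓ + 1) M') → ℝ) :
    ψ ⬝ᵥ (blockP ℓ M').mulVec ψ
      = (1 / ((ℓ : ℝ) + 1) ^ d) * ((ind ℓ M').mulVec ψ ⬝ᵥ (ind ℓ M').mulVec ψ) := by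
  rw [blockP, Matrix.smul_mulVec, dotProduct_smul, smul_eq_mul, ← Matrix.mulVec_mulVec,
    Matrix.dotProduct_mulVec ψ (ind ℓ M')ᵀ, Matrix.vecMul_transpose]

/-- **block sums are controlled by the block size**: `‖ind ψ‖² ≤ L^d ‖ψ‖²` (Cauchy–Schwarz per block). [folklore] -/
theorem ind_normSq_le (ψ : Tor (fine (ℓ + 1) M') → ℝ) :
    (ind ℓ M').mulVec ψ ⬝ᵥ (ind ℓ M').mulVec ψ ≤ ((ℓ : ℝ) + 1) ^ d * (ψ ⬝ᵥ ψ) := by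
  have hcard : ((Finset.univ : Finset (Fin d → Fin (ℓ + 1))).card : ℝ) = ((ℓ : ℝ) + 1) ^ d := by
    rw [Finset.card_univ, Fintype.card_fun, Fintype.card_fin, Fintype.card_fin]; push_cast; ring
  have hψ : ψ ⬝ᵥ ψ = ∑ B : Tor M', ∑ j : Fin d → Fin (ℓ + 1), ψ (B5Block118.bpt (ℓ + 1) M' B j) ^ 2 := by
    rw [← sum_fine_eq_sum_blocks ℓ M' (fun x => ψ x ^ 2)]
    simp only [dotProduct, sq]
  rw [hψ, Finset.mul_sum]
  refine Finset.sum_le_sum fun B _ => ?_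
  rw [ind_mulVec_eq ℓ M' ψ B]
  have h := Finset.sum_mul_sq_le_sq_mul_sq (Finset.univ : Finset (Fin d → Fin (ℓ + 1))) (fun _ => (1 : ℝ))
    (fun j => ψ (B5Block118.bpt (ℓ + 1) M' B j))
  simp only [one_mul, one_pow, Finset.sum_const, nsmul_eq_mul, mul_one] at h
  rw [hcard] at h
  rw [← sq]
  exact h

/-- `0 ≤ ⟨ψ, blockP ψ⟩ ≤ ‖ψ‖²` (an orthogonal projection). [folklore] -/
theorem blockP_form_nonneg (ψ : Tor (fine (ℓ + 1) M') → ℝ) : 0 ≤ ψ ⬝ᵥ (blockP ℓ M').mulVec ψ := by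
  rw [blockP_form]
  refine mul_nonneg (by positivity) ?_
  exact Finset.sum_nonneg fun B _ => mul_self_nonneg _

/-- `⟨ψ, blockP ψ⟩ ≤ ‖ψ‖²`. [folklore] -/
theorem blockP_form_le (ψ : Tor (fine (ℓ + 1) M') → ℝ) : ψ ⬝ᵥ (blockP ℓ M').mulVec ψ ≤ ψ ⬝ᵥ ψ := by
  rw [blockP_form]
  have hL : (0 : ℝ) < ((ℓ : ℝ) + 1) ^ d := by positivity
  calc 1 / ((ℓ : ℝ) + 1) ^ d * ((ind ℓ M').mulVec ψ ⬝ᵥ (ind ℓ M').mulVec ψ)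
      ≤ 1 / ((ℓ : ℝ) + 1) ^ d * (((ℓ : ℝ) + 1) ^ d * (ψ ⬝ᵥ ψ)) :=
        mul_le_mul_of_nonneg_left (ind_normSq_le ℓ M' ψ) (by positivity)
    _ = ψ ⬝ᵥ ψ := by field_simp

/-! ## §4  (1.15): two-sided form bounds for `Cop`, uniform in the mesh and the volume -/

/-- an5's coercivity constant `c_K = min(a₁/(8d), 1/2)` of `K_eff ≥ c_K·(−Δ₁)`. [folklore] -/
def cK (d : ℕ) (a₁ : ℝ) : ℝ := min (a₁ / (8 * d)) (1 / 2)

/-- **the lower constant of (1.15)**: `gamma0 = min(2c_K, a₂)/L²`. [folklore] -/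
def gamma0 (d ℓ : ℕ) (a₁ a₂ : ℝ) : ℝ := min (2 * cK d a₁) a₂ / ((ℓ : ℝ) + 1) ^ 2

/-- **the upper constant of (1.15)**: `gamma1 = a₁ + a₂/L²`. [folklore] -/
def gamma1 (ℓ : ℕ) (a₁ a₂ : ℝ) : ℝ := a₁ + a₂ / ((ℓ : ℝ) + 1) ^ 2

/-- `c_K > 0` for `d ≥ 1`, `a₁ > 0`. [folklore] -/
theorem cK_pos (hd : 1 ≤ d) {a₁ : ℝ} (ha₁ : 0 < a₁) : 0 < cK d a₁ := by
  unfold cK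
  have : (0 : ℝ) < d := by exact_mod_cast hd
  exact lt_min (by positivity) (by norm_num)

/-- `gamma0 > 0` for `d ≥ 1`, `a₁, a₂ > 0`. [folklore] -/
theorem gamma0_pos (hd : 1 ≤ d) (ℓ : ℕ) {a₁ a₂ : ℝ} (ha₁ : 0 < a₁) (ha₂ : 0 < a₂) : 0 < gamma0 d ℓ a₁ a₂ := by
  unfold gamma0
  have := cK_pos hd ha₁
  exact div_pos (lt_min (by positivity) ha₂) (by positivity)

/-- the form of `Cop` splits. [folklore] -/
theorem Cop_form_eq (a₁ a₂ : ℝ) (ψ : Tor (fine (ℓ + 1) M') → ℝ) :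
    ψ ⬝ᵥ (Cop n ℓ M' a₁ a₂).mulVec ψ
      = ψ ⬝ᵥ (Keff n (fine (ℓ + 1) M') a₁).mulVec ψ + a₂ / ((ℓ : ℝ) + 1) ^ 2 * (ψ ⬝ᵥ (blockP ℓ M').mulVec ψ) := by
  rw [Cop, Matrix.add_mulVec, dotProduct_add, Matrix.smul_mulVec, dotProduct_smul, smul_eq_mul]

omit hM in
/-- the unit periods `≥ 3` imply the fine periods `≥ 3`. [folklore] -/
theorem fine_periods_ge_three (h3 : ∀ μ, 3 ≤ fine (ℓ + 1) M' μ) (μ : Fin d) :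
    3 ≤ fine (n + 1) (fine (ℓ + 1) M') μ := by
  have h := h3 μ
  simp only [fine] at h ⊢
  calc 3 ≤ (ℓ + 1) * M' μ := h
    _ ≤ (n + 1) * ((ℓ + 1) * M' μ) := Nat.le_mul_of_pos_left _ (Nat.succ_pos n)

/-- **THE BLOCK POINCARÉ INEQUALITY WITH THE NEXT CONSTRAINT** on the unit torus:
`min(2c, a₂)/L² · ‖ψ‖² ≤ c·E(ψ) + (a₂/L²)·⟨ψ, Q_L*Q_L ψ⟩` for every `c > 0`, `a₂ ≥ 0` — pv23-g3's `coercive_torus` on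
`U = Tor (fine (ℓ+1) M′)` with parameter `a₂/c`, rescaled by `c/L²` (§2 turns its Laplacian form into `L²·E`). [folklore] -/
theorem dirichletT_blockP_coercive (h3 : ∀ μ, 3 ≤ fine (ℓ + 1) M' μ) {c a₂ : ℝ} (hc : 0 < c) (ha₂ : 0 ≤ a₂)
    (ψ : Tor (fine (ℓ + 1) M') → ℝ) :
    min (2 * c) a₂ / ((ℓ : ℝ) + 1) ^ 2 * (ψ ⬝ᵥ ψ)
      ≤ c * dirichletT (fine (ℓ + 1) M') ψ + a₂ / ((ℓ : ℝ) + 1) ^ 2 * (ψ ⬝ᵥ (blockP ℓ M').mulVec ψ) := by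
  have hL : (0 : ℝ) < ((ℓ : ℝ) + 1) ^ 2 := by positivity
  have hLd : (0 : ℝ) < ((ℓ : ℝ) + 1) ^ d := by positivity
  have hco := coercive_torus ℓ M' h3 (div_nonneg ha₂ hc.le) ψ
  rw [torusOp_form_eq, lap_form_eq_dirichletT _ h3 hL.ne' ψ] at hco
  rw [blockP_form]
  -- `c · min(2, a₂/c) = min(2c, a₂)`
  have hmin : c * min 2 (a₂ / c) = min (2 * c) a₂ := by
    rcases le_total 2 (a₂ / c) with h | h
    · rw [min_eq_left h, min_eq_left ((le_div_iff₀ hc).mp h)]; ring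
    · rw [min_eq_right h, min_eq_right ((div_le_iff₀ hc).mp h)]; field_simp
  -- rescale `hco` by `c/L²`
  have key : c / ((ℓ : ℝ) + 1) ^ 2 * (min 2 (a₂ / c) * (ψ ⬝ᵥ ψ))
      ≤ c / ((ℓ : ℝ) + 1) ^ 2 * (((ℓ : ℝ) + 1) ^ 2 * dirichletT (fine (ℓ + 1) M') ψ
          + a₂ / c / ((ℓ : ℝ) + 1) ^ d * ((ind ℓ M').mulVec ψ ⬝ᵥ (ind ℓ M').mulVec ψ)) :=
    mul_le_mul_of_nonneg_left hco (by positivity)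
  have e1 : c / ((ℓ : ℝ) + 1) ^ 2 * (min 2 (a₂ / c) * (ψ ⬝ᵥ ψ)) = min (2 * c) a₂ / ((ℓ : ℝ) + 1) ^ 2 * (ψ ⬝ᵥ ψ) := by
    rw [← hmin]; ring
  have e2 : c / ((ℓ : ℝ) + 1) ^ 2 * (((ℓ : ℝ) + 1) ^ 2 * dirichletT (fine (ℓ + 1) M') ψ
          + a₂ / c / ((ℓ : ℝ) + 1) ^ d * ((ind ℓ M').mulVec ψ ⬝ᵥ (ind ℓ M').mulVec ψ))
      = c * dirichletT (fine (ℓ + 1) M') ψ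
          + a₂ / ((ℓ : ℝ) + 1) ^ 2 * (1 / ((ℓ : ℝ) + 1) ^ d * ((ind ℓ M').mulVec ψ ⬝ᵥ (ind ℓ M').mulVec ψ)) := by
    field_simp
  rw [e1, e2] at key
  exact key

/-- **(1.15), LOWER BOUND, KERNEL**: `gamma0 · ‖ψ‖² ≤ ⟨ψ, Cop ψ⟩` for every mesh `n`, every volume `M′` with unit periods
`(ℓ+1)M′_μ ≥ 3`, every `a₁ > 0`, `a₂ ≥ 0`. [folklore] -/
theorem Cop_form_ge (h3 : ∀ μ, 3 ≤ fine (ℓ + 1) M' μ) (hd : 1 ≤ d) {a₁ a₂ : ℝ} (ha₁ : 0 < a₁) (ha₂ : 0 ≤ a₂)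
    (ψ : Tor (fine (ℓ + 1) M') → ℝ) :
    gamma0 d ℓ a₁ a₂ * (ψ ⬝ᵥ ψ) ≤ ψ ⬝ᵥ (Cop n ℓ M' a₁ a₂).mulVec ψ := by
  rw [Cop_form_eq, gamma0]
  have hK := Keff_form_ge_dirichletT n (fine (ℓ + 1) M') (fine_periods_ge_three n ℓ M' h3) ha₁ ψ
  have hP := dirichletT_blockP_coercive ℓ M' h3 (cK_pos hd ha₁) ha₂ ψ
  rw [show min (a₁ / (8 * d)) (1 / 2) = cK d a₁ from rfl] at hK
  linarith

/-- **(1.15), UPPER BOUND, KERNEL**: `⟨ψ, Cop ψ⟩ ≤ gamma1 · ‖ψ‖²`. [folklore] -/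
theorem Cop_form_le (h3 : ∀ μ, 3 ≤ fine (ℓ + 1) M' μ) {a₁ a₂ : ℝ} (ha₁ : 0 < a₁) (ha₂ : 0 ≤ a₂)
    (ψ : Tor (fine (ℓ + 1) M') → ℝ) :
    ψ ⬝ᵥ (Cop n ℓ M' a₁ a₂).mulVec ψ ≤ gamma1 ℓ a₁ a₂ * (ψ ⬝ᵥ ψ) := by
  rw [Cop_form_eq, gamma1, add_mul]
  have hK := Keff_form_le n (fine (ℓ + 1) M') (fine_periods_ge_three n ℓ M' h3) ha₁ ψ
  have hP := blockP_form_le ℓ M' ψ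
  have : a₂ / ((ℓ : ℝ) + 1) ^ 2 * (ψ ⬝ᵥ (blockP ℓ M').mulVec ψ) ≤ a₂ / ((ℓ : ℝ) + 1) ^ 2 * (ψ ⬝ᵥ ψ) :=
    mul_le_mul_of_nonneg_left hP (by positivity)
  linarith

/-! ## §5  (5.6): symmetry and entry decay of `Cop` -/

/-- `Cop` is symmetric. [folklore] -/
theorem Cop_transpose (a₁ a₂ : ℝ) : (Cop n ℓ M' a₁ a₂)ᵀ = Cop n ℓ M' a₁ a₂ := by
  rw [Cop, Matrix.transpose_add, Matrix.transpose_smul, Keff_transpose, blockP_transpose]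

/-- **the (5.6) rate**: an5's standard Combes–Thomas rate capped at `1/L` (so that one `L`-block costs a factor `≤ e`).
[folklore] -/
def delta0 (d ℓ : ℕ) (a₁ : ℝ) : ℝ := min (deltaStd d a₁) (1 / ((ℓ : ℝ) + 1))

/-- **the (5.6) constant** `c0 = a₁ + e·(a₁²(2/min(2,a₁)) + a₂/(L² L^d))`. [folklore] -/
def c0 (d ℓ : ℕ) (a₁ a₂ : ℝ) : ℝ :=
  a₁ + Real.exp 1 * (a₁ ^ 2 * (2 / min 2 a₁) + a₂ / (((ℓ : ℝ) + 1) ^ 2 * ((ℓ : ℝ) + 1) ^ d))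

/-- `delta0 > 0`. [folklore] -/
theorem delta0_pos (ℓ : ℕ) {a₁ : ℝ} (ha₁ : 0 < a₁) : 0 < delta0 d ℓ a₁ :=
  lt_min (deltaStd_pos (d := d) ha₁) (by positivity)

/-- `delta0 ≤ δ_std`. [folklore] -/
theorem delta0_le_deltaStd (ℓ : ℕ) (a₁ : ℝ) : delta0 d ℓ a₁ ≤ deltaStd d a₁ := min_le_left _ _

/-- `delta0 · ℓ ≤ 1`: the same-block range costs at most a factor `e`. [folklore] -/
theorem delta0_mul_le_one (ℓ : ℕ) (a₁ : ℝ) : delta0 d ℓ a₁ * ℓ ≤ 1 := by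
  have hℓ : (0 : ℝ) ≤ ℓ := Nat.cast_nonneg ℓ
  have h1 : delta0 d ℓ a₁ ≤ 1 / ((ℓ : ℝ) + 1) := min_le_right _ _
  calc delta0 d ℓ a₁ * ℓ ≤ 1 / ((ℓ : ℝ) + 1) * ℓ := mul_le_mul_of_nonneg_right h1 hℓ
    _ ≤ 1 := by rw [div_mul_eq_mul_div, one_mul, div_le_one (by positivity)]; linarith

/-- `c0 > 0`. [folklore] -/
theorem c0_pos (ℓ : ℕ) {a₁ a₂ : ℝ} (ha₁ : 0 < a₁) (ha₂ : 0 ≤ a₂) : 0 < c0 d ℓ a₁ a₂ := by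
  unfold c0
  have : 0 < min 2 a₁ := lt_min two_pos ha₁
  positivity

/-- **(5.6), ENTRY BOUND, KERNEL**: `|Cop(b,b′)| ≤ c0 · e^{−delta0 · ldist_U(b,b′)}` for every mesh and volume
(unit periods `≥ 3`), `a₁ > 0`, `a₂ ≥ 0`. [folklore] -/
theorem Cop_entry_bound (h3 : ∀ μ, 3 ≤ fine (ℓ + 1) M' μ) {a₁ a₂ : ℝ} (ha₁ : 0 < a₁) (ha₂ : 0 ≤ a₂)
    (b b' : Tor (fine (ℓ + 1) M')) :
    |Cop n ℓ M' a₁ a₂ b b'| ≤ c0 d ℓ a₁ a₂ * Real.exp (-(delta0 d ℓ a₁ * ldist (fine (ℓ + 1) M') b b')) := by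
  set δ := delta0 d ℓ a₁ with hδ
  set R := ldist (fine (ℓ + 1) M') b b' with hR
  have hR0 : 0 ≤ R := (IsPseudoDist.nonneg ⟨ldist_symm _, ldist_self _, ldist_triangle _⟩ b b')
  have hδ0 : 0 < δ := delta0_pos ℓ ha₁
  have hσ : 0 < min 2 a₁ := lt_min two_pos ha₁
  have hE : 0 < Real.exp (-(δ * R)) := Real.exp_pos _
  -- (i) the `K_eff` part at an5's standard rate
  have hK := Keff_abs_le n (fine (ℓ + 1) M') (fine_periods_ge_three n ℓ M' h3) ha₁ (deltaStd_pos (d := d) ha₁).le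
    (deltaStd_le_one (d := d) ha₁) (deltaStd_small (d := d) ha₁) b b'
  have hK1 : (if b = b' then a₁ else 0) ≤ a₁ * Real.exp (-(δ * R)) := by
    split_ifs with hbb
    · rw [hR, hbb, ldist_self, mul_zero, neg_zero, Real.exp_zero, mul_one]
    · positivity
  have hK2 : a₁ ^ 2 * (2 / min 2 a₁) * Real.exp (deltaStd d a₁) * Real.exp (-(deltaStd d a₁ * R))
      ≤ a₁ ^ 2 * (2 / min 2 a₁) * Real.exp 1 * Real.exp (-(δ * R)) := by
    have h1 : Real.exp (deltaStd d a₁) ≤ Real.exp 1 := Real.exp_le_exp.mpr (deltaStd_le_one (d := d) ha₁)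
    have h2 : Real.exp (-(deltaStd d a₁ * R)) ≤ Real.exp (-(δ * R)) := by
      apply Real.exp_le_exp.mpr
      have := mul_le_mul_of_nonneg_right (delta0_le_deltaStd (d := d) ℓ a₁) hR0
      linarith
    have h3' : 0 ≤ a₁ ^ 2 * (2 / min 2 a₁) := by positivity
    calc a₁ ^ 2 * (2 / min 2 a₁) * Real.exp (deltaStd d a₁) * Real.exp (-(deltaStd d a₁ * R))
        ≤ a₁ ^ 2 * (2 / min 2 a₁) * Real.exp 1 * Real.exp (-(deltaStd d a₁ * R)) := by gcongr
      _ ≤ a₁ ^ 2 * (2 / min 2 a₁) * Real.exp 1 * Real.exp (-(δ * R)) := by gcongr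
  -- (ii) the `blockP` part: supported on the same block, where `ldist ≤ ℓ` and `δℓ ≤ 1`
  have hP : |a₂ / ((ℓ : ℝ) + 1) ^ 2 * blockP ℓ M' b b'|
      ≤ a₂ / (((ℓ : ℝ) + 1) ^ 2 * ((ℓ : ℝ) + 1) ^ d) * Real.exp 1 * Real.exp (-(δ * R)) := by
    rw [abs_mul, abs_of_nonneg (by positivity : (0 : ℝ) ≤ a₂ / ((ℓ : ℝ) + 1) ^ 2)]
    by_cases hbl : B5Blocks16.blockOf (ℓ + 1) M' b = B5Blocks16.blockOf (ℓ + 1) M' b'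
    · have hRl : R ≤ ℓ := ldist_le_of_same_block ℓ M' hbl
      have h1 : 1 ≤ Real.exp 1 * Real.exp (-(δ * R)) := by
        rw [← Real.exp_add]
        have : 0 ≤ 1 + -(δ * R) := by
          have := delta0_mul_le_one (d := d) ℓ a₁
          have : δ * R ≤ δ * ℓ := mul_le_mul_of_nonneg_left hRl hδ0.le
          linarith
        exact Real.one_le_exp this
      calc a₂ / ((ℓ : ℝ) + 1) ^ 2 * |blockP ℓ M' b b'|
          ≤ a₂ / ((ℓ : ℝ) + 1) ^ 2 * (1 / ((ℓ : ℝ) + 1) ^ d) :=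
            mul_le_mul_of_nonneg_left (blockP_apply_abs_le ℓ M' b b') (by positivity)
        _ = a₂ / (((ℓ : ℝ) + 1) ^ 2 * ((ℓ : ℝ) + 1) ^ d) * 1 := by field_simp
        _ ≤ a₂ / (((ℓ : ℝ) + 1) ^ 2 * ((ℓ : ℝ) + 1) ^ d) * (Real.exp 1 * Real.exp (-(δ * R))) :=
            mul_le_mul_of_nonneg_left h1 (by positivity)
        _ = _ := by ring
    · rw [blockP_apply_of_ne ℓ M' hbl, abs_zero, mul_zero]; positivity
  -- assemble
  have hsum : |Cop n ℓ M' a₁ a₂ b b'|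
      ≤ |Keff n (fine (ℓ + 1) M') a₁ b b'| + |a₂ / ((ℓ : ℝ) + 1) ^ 2 * blockP ℓ M' b b'| := by
    rw [Cop, Matrix.add_apply, Matrix.smul_apply, smul_eq_mul]
    exact abs_add_le _ _
  calc |Cop n ℓ M' a₁ a₂ b b'|
      ≤ ((if b = b' then a₁ else 0)
          + a₁ ^ 2 * (2 / min 2 a₁) * Real.exp (deltaStd d a₁) * Real.exp (-(deltaStd d a₁ * R)))
        + a₂ / (((ℓ : ℝ) + 1) ^ 2 * ((ℓ : ℝ) + 1) ^ d) * Real.exp 1 * Real.exp (-(δ * R)) :=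
        hsum.trans (add_le_add hK hP)
    _ ≤ (a₁ * Real.exp (-(δ * R)) + a₁ ^ 2 * (2 / min 2 a₁) * Real.exp 1 * Real.exp (-(δ * R)))
        + a₂ / (((ℓ : ℝ) + 1) ^ 2 * ((ℓ : ℝ) + 1) ^ d) * Real.exp 1 * Real.exp (-(δ * R)) := by
        gcongr
    _ = c0 d ℓ a₁ a₂ * Real.exp (-(δ * R)) := by rw [c0]; ring

/-- **HYPOTHESIS (5.6) OF B4 §5, CERTIFIED** for `Cop` with the torus sup-distance `ldist`:
symmetric, `≥ gamma0`, entries `≤ c0 e^{−delta0·ldist}`. [folklore] -/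
theorem Cop_hyp56 (h3 : ∀ μ, 3 ≤ fine (ℓ + 1) M' μ) (hd : 1 ≤ d) {a₁ a₂ : ℝ} (ha₁ : 0 < a₁) (ha₂ : 0 ≤ a₂) :
    Hyp56 (ldist (fine (ℓ + 1) M')) (Cop n ℓ M' a₁ a₂) (gamma0 d ℓ a₁ a₂) (c0 d ℓ a₁ a₂) (delta0 d ℓ a₁) := by
  refine ⟨Cop_transpose n ℓ M' a₁ a₂, fun v => ?_, fun p q => Cop_entry_bound n ℓ M' h3 ha₁ ha₂ p q⟩
  have h := Cop_form_ge n ℓ M' h3 hd ha₁ ha₂ v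
  have e1 : v ⬝ᵥ v = ∑ p, v p ^ 2 := by simp [dotProduct, pow_two]
  have e2 : v ⬝ᵥ (Cop n ℓ M' a₁ a₂).mulVec v = ∑ p, v p * (Cop n ℓ M' a₁ a₂).mulVec v p := rfl
  rw [e1, e2] at h
  exact h

/-! ## §6  (1.16): exponential decay of the fluctuation covariance, uniform in the mesh and the volume -/

/-- the torus sup-distance is a pseudo-distance (pv23-g3). [folklore] -/
theorem ldist_isPseudoDist {N : Fin d → ℕ} [∀ μ, NeZero (N μ)] : IsPseudoDist (ldist N) :=
  ⟨ldist_symm N, ldist_self N, ldist_triangle N⟩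

/-- the torus has the uniform lattice-sum profile `K_d` (an5-g4 / pv09-g4). [folklore] -/
theorem ldist_sumBound {N : Fin d → ℕ} [∀ μ, NeZero (N μ)] : SumBound (ldist N) (latticeConst d) :=
  fun _ hc x => sum_exp_ldist_le N x hc

/-- **the certified (1.16) rate** `delta1 = min(delta0/4, gamma0/(2M₀ + 1))`, `M₀ = c0·(4/delta0)·K_d(delta0/2)`
(pv09's `B4Sect5Torus.rate` with the torus profile). [folklore] -/
def delta1 (d ℓ : ℕ) (a₁ a₂ : ℝ) : ℝ := rate (latticeConst d) (gamma0 d ℓ a₁ a₂) (c0 d ℓ a₁ a₂) (delta0 d ℓ a₁)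

/-- `delta1 > 0`. [folklore] -/
theorem delta1_pos (hd : 1 ≤ d) (ℓ : ℕ) {a₁ a₂ : ℝ} (ha₁ : 0 < a₁) (ha₂ : 0 < a₂) : 0 < delta1 d ℓ a₁ a₂ :=
  rate_pos (fun _ ha => latticeConst_nonneg d ha.le) (gamma0_pos hd ℓ ha₁ ha₂) (c0_pos (d := d) ℓ ha₁ ha₂.le).le
    (delta0_pos (d := d) ℓ ha₁)

/-- **B4 (1.16) ON THE TORUS AT `A = 0`, KERNEL — ENTRY DECAY OF THE FLUCTUATION COVARIANCE, UNIFORM IN THE MESH AND THE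
VOLUME.**  For `d ≥ 1`, `a₁, a₂ > 0`, every `ℓ` and `M′` with unit periods `(ℓ+1)M′_μ ≥ 3` and EVERY mesh `n`:
`|Cfl(b,b′)| ≤ (2/gamma0) · exp(−delta1 · ldist_U(b,b′))` for all unit sites `b, b′`. [folklore] -/
theorem Cfl_entry_decay (h3 : ∀ μ, 3 ≤ fine (ℓ + 1) M' μ) (hd : 1 ≤ d) {a₁ a₂ : ℝ} (ha₁ : 0 < a₁) (ha₂ : 0 < a₂)
    (b b' : Tor (fine (ℓ + 1) M')) :
    |Cfl n ℓ M' a₁ a₂ b b'|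
      ≤ 2 / gamma0 d ℓ a₁ a₂ * Real.exp (-(delta1 d ℓ a₁ a₂ * ldist (fine (ℓ + 1) M') b b')) :=
  inv_decay (fun _ ha => latticeConst_nonneg d ha.le) (gamma0_pos hd ℓ ha₁ ha₂) (c0_pos (d := d) ℓ ha₁ ha₂.le).le
    (delta0_pos (d := d) ℓ ha₁) ldist_isPseudoDist ldist_sumBound (Cop_hyp56 n ℓ M' h3 hd ha₁ ha₂.le) b b'

/-- **B4 (1.16) WITH `Λ`, KERNEL**: the SAME bound with the SAME constants for the covariance `((Cop)|_Λ)⁻¹` compressed to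
ANY subset `Λ = range e` of the unit torus (`e` an injection; B4 asks `Λ` to be a union of big blocks — not needed here).
[folklore] -/
theorem Cfl_submatrix_entry_decay (h3 : ∀ μ, 3 ≤ fine (ℓ + 1) M' μ) (hd : 1 ≤ d) {a₁ a₂ : ℝ} (ha₁ : 0 < a₁)
    (ha₂ : 0 < a₂) {m : Type*} [Fintype m] [DecidableEq m] {e : m → Tor (fine (ℓ + 1) M')}
    (he : Function.Injective e) (i j : m) :
    |((Cop n ℓ M' a₁ a₂).submatrix e e)⁻¹ i j|
      ≤ 2 / gamma0 d ℓ a₁ a₂ * Real.exp (-(delta1 d ℓ a₁ a₂ * ldist (fine (ℓ + 1) M') (e i) (e j))) :=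
  inv_submatrix_decay (fun _ ha => latticeConst_nonneg d ha.le) (gamma0_pos hd ℓ ha₁ ha₂)
    (c0_pos (d := d) ℓ ha₁ ha₂.le).le (delta0_pos (d := d) ℓ ha₁) ldist_isPseudoDist ldist_sumBound
    (Cop_hyp56 n ℓ M' h3 hd ha₁ ha₂.le) he i j

/-- **(1.15) + (1.16) TOGETHER, in the printed shape** (∃ positive constants independent of the mesh `n` and of the volume
`M′`): for `d ≥ 1`, `a₁, a₂ > 0` and every `ℓ` there are `γ₀, γ₁, c₁, δ₁ > 0` (the explicit ones above) with
`γ₀‖ψ‖² ≤ ⟨ψ, Cop ψ⟩ ≤ γ₁‖ψ‖²` and `|Cfl(b,b′)| ≤ c₁e^{−δ₁ ldist(b,b′)}` on every unit torus with periods `≥ 3` and every mesh.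
[folklore] -/
theorem prop23_torus (hd : 1 ≤ d) (ℓ : ℕ) {a₁ a₂ : ℝ} (ha₁ : 0 < a₁) (ha₂ : 0 < a₂) :
    ∃ γ₀ γ₁ c₁ δ₁ : ℝ, 0 < γ₀ ∧ 0 < γ₁ ∧ 0 < c₁ ∧ 0 < δ₁ ∧
      ∀ (n : ℕ) (M' : Fin d → ℕ) [∀ μ, NeZero (M' μ)], (∀ μ, 3 ≤ fine (ℓ + 1) M' μ) →
        (∀ ψ : Tor (fine (ℓ + 1) M') → ℝ,
            γ₀ * (ψ ⬝ᵥ ψ) ≤ ψ ⬝ᵥ (Cop n ℓ M' a₁ a₂).mulVec ψ ∧ ψ ⬝ᵥ (Cop n ℓ M' a₁ a₂).mulVec ψ ≤ γ₁ * (ψ ⬝ᵥ ψ)) ∧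
        (∀ b b' : Tor (fine (ℓ + 1) M'),
            |Cfl n ℓ M' a₁ a₂ b b'| ≤ c₁ * Real.exp (-(δ₁ * ldist (fine (ℓ + 1) M') b b'))) := by
  refine ⟨gamma0 d ℓ a₁ a₂, gamma1 ℓ a₁ a₂, 2 / gamma0 d ℓ a₁ a₂, delta1 d ℓ a₁ a₂, gamma0_pos hd ℓ ha₁ ha₂, ?_,
    div_pos two_pos (gamma0_pos hd ℓ ha₁ ha₂), delta1_pos hd ℓ ha₁ ha₂, fun n M' _ h3 => ⟨fun ψ => ?_, fun b b' => ?_⟩⟩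
  · unfold gamma1; positivity
  · exact ⟨Cop_form_ge n ℓ M' h3 hd ha₁ ha₂.le ψ, Cop_form_le n ℓ M' h3 ha₁ ha₂.le ψ⟩
  · exact Cfl_entry_decay n ℓ M' h3 hd ha₁ ha₂ b b'

end Setting

/-! ## §7  Non-vacuity (d = 4, L = 3, one coarse block, a₁ = a₂ = 1) -/

section Sanity

/-- the hypotheses are met: `d = 4`, `ℓ = 2` (`L = 3`), `M′ ≡ 1`, any mesh. [folklore] -/
example : ∀ μ : Fin 4, 3 ≤ fine (2 + 1) (fun _ : Fin 4 => 1) μ := fun μ => by simp [fine]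

/-- the certified constants are positive at `d = 4`, `L = 3`, `a₁ = a₂ = 1`. [folklore] -/
example : 0 < gamma0 4 2 1 1 ∧ 0 < delta1 4 2 1 1 :=
  ⟨gamma0_pos (by norm_num) 2 one_pos one_pos, delta1_pos (by norm_num) 2 one_pos one_pos⟩

/-- (1.16) instantiated: `d = 4`, `L = 3`, one coarse block per direction, `a₁ = a₂ = 1`, mesh `1/(n+1)` arbitrary. [folklore] -/
example (n : ℕ) (b b' : Tor (fine (2 + 1) (fun _ : Fin 4 => 1))) :
    |Cfl n 2 (fun _ : Fin 4 => 1) 1 1 b b'|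
      ≤ 2 / gamma0 4 2 1 1 * Real.exp (-(delta1 4 2 1 1 * ldist (fine (2 + 1) (fun _ : Fin 4 => 1)) b b')) :=
  Cfl_entry_decay n 2 (fun _ => 1) (fun μ => by simp [fine]) (by norm_num) one_pos one_pos b b'

end Sanity

end

end Literature.MathematicalPhysics.QuantumFieldTheory.Balaban1983to89.Beta.FluctuationCovariance
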